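import Summits.BirchSwinnertonDyer.BirchSwinnertonDyer.Theorems.ThetaPartnerAtTwoSignedMainConjectureCMTwoRankZeroOfLowerUpToTwoPower
import Summits.BirchSwinnertonDyer.BirchSwinnertonDyer.Theorems.ThetaPartnerAtTwoSignedMainConjectureCMTwoRankZeroStubPlusHondaSystemCMTwo
import HarnessLib

/-!
# Route `ThetaPartnerAtTwo` (TP2), crux K2r0 `SignedMainConjectureCMTwoRankZero` (stmt-BirchSwinnertonDyer-20312), line
# `rankzero` v12: with HONDA⁺@2 LANDED the crux holds ON THE UNIT ZONE from PUBLISHED inputs alone, and OFF the zone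
# it is the two global research binders (LD±2^k)_A, (μ♭)_A plus print

HONEST FRAMING (cell `pub/bsd-wall`, W-ALL row 1, lead prover `bsd-wall-tp2-p2` g5). The crux K2r0 — Kobayashi's `+` main conjecture
at `2` with `μ⁺ = 0` for EVERY CM curve `A/ℚ` of analytic rank `0`, good supersingular at `2`, `a₂ = 0` — is NOT proved here and
NOT in print (Pollack–Rubin 2004 is `p > 2`). WHAT IS PROVED (no research binder, no `sorry`, no definition): the `±` local theory
at `2` having landed in the kernel (`SignedEC.PlusLayer.plusHondaSystemTwo_adicCompletion`, p592468 ← p591589, K4 seats; Kobayashi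
§8.4 read at `2` on the real-cyclotomic `ℤ₂`-tower, Honda type `T² + 2`), the doors of this line give

* §1 **`signedMainConjectureCMTwoRankZero_at_unitZone_of_pub`** — for every such `A` IN THE UNIT ZONE (`2 ∤ #Ш(A)·∏_ℓ c_ℓ(A)`,
  equivalently `ord₂ L(A,1)/Ω_A = 0`), BOTH conjuncts of the crux AT `A` (`X⁺(A/ℚ_∞)` torsion with `μ⁺ = 0` at every cyclotomic
  top-generator pair, and `KobayashiMainConjecture A 2 1`) GRANTED ONLY PUBLISHED INPUTS BY NAME: Burungale–Flach 2024 (BSD₂ for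
  CM rank `0`), modularity (parametrisation datum; entire `L`), Gross–Zagier–Kolyvagin, the period unit at `2` (Abbes–Ullmo), and
  the five Greenberg LNM 1716 structure facts (Cassels surjectivity, Prop. 4.12, corank bound, p. 108, weak Leopoldt). The content
  is rank-0 control: `Sel_{2^∞}(A/ℚ)·∏c_ℓ` is a `2`-adic unit, so the `+` Euler characteristic vanishes and `X⁺ = 0`, while
  `ϖ·L♭(0) = L(A,1)/Ω_A` is a unit, so `(ϖ·L♭) = Λ = char X⁺` (g4's `signedMainConjectureCMTwoRankZero_at_unitZone_of_honda`,
  p588365/p585652, now fed the landed HONDA).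
* §1 `…_at_unitZone_of_pubConj` — the same with the ten facts bundled as the registered PUB stub's conjunction (the shape of the
  skeleton and of the T10v2 twin K2r0P's antecedents).
* §2 **`signedMainConjectureCMTwoRankZero_at_of_pub_of_lowerUpToTwoPower_of_flat`** — OFF the unit zone: PUB + (LD±2^k)_A (the
  one-sided Eisenstein half in `Λ ⊗ ℚ₂`, p592928) + (μ♭)_A ⇒ the crux AT `A` (HONDA discharged). The crux BY NAME from PUB + the
  two global research binders is the composition of the registered skeleton `Cruxes/SignedMainConjectureCMTwoRankZero/Lines/rankzero.lean`
  v12 (this file is route-independent and imports no `Theses` module).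
Nothing about any curve is asserted beyond the displayed binders; BSD is not proved by any of this.

References: [PollackRubin2004] Thm. 7.3 (p > 2), Thm. 8.2; [Kobayashi2003] Thm. 1.2, §8.4, Conjecture (p. 2); [BurungaleFlach2024]
Thm. 1.1; [BDKim2013] Cor. 3.15; [GreenbergLNM1716] Prop. 4.12, Prop. 4.13, pp. 108, 119–120, 140; [AbbesUllmo1996] Thm. A.
-/

set_option autoImplicit false
-- the Theorems namespace of this sub repeats the summit name by design (D-0017 nested layout)
set_option linter.dupNamespace false

noncomputable section

open scoped Classical NumberField MatrixGroups ModularForm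

open NumberField IsDedekindDomain CongruenceSubgroup

namespace Summit.BirchSwinnertonDyer.BirchSwinnertonDyer.Theorems

open Literature.NumberTheory.EllipticCurves Literature.NumberTheory.GaloisRepresentations
  WeierstrassCurve ZpExtension Literature.NumberTheory.EllipticCurves.Kobayashi2003
  Literature.NumberTheory.EllipticCurves.IwasawaDual Literature.NumberTheory.EllipticCurves.GreenbergVatsal2000
  Literature.NumberTheory.EllipticCurves.ModularForms Literature.NumberTheory.EllipticCurves.Rank1Residual
  Literature.NumberTheory.EllipticCurves.Rank1Residual.Typed
  Summit.BirchSwinnertonDyer.Rank1Residual Summit.BirchSwinnertonDyer.Rank1Residual.Supersingular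

/-! ## §1. The unit zone: the crux AT `A` from published inputs alone -/

/-- **K2r0 ON THE UNIT ZONE FROM PRINT.** For every CM curve `A/ℚ` (globally minimal) of analytic rank `0`, good supersingular at `2`
with `a₂ = 0`, and `2 ∤ #Ш(A)·∏_ℓ c_ℓ(A)`: `X⁺(A/ℚ_∞)` is `Λ`-torsion with `μ⁺ = 0` at every cyclotomic top-generator pair and
Kobayashi's `+` main conjecture `KobayashiMainConjecture A 2 1` holds — GRANTED BY NAME only Burungale–Flach (`hBF`), modularity
(`hmod`, `hLrat`), Gross–Zagier–Kolyvagin (`hGZK`), the period unit at `2` (`h2`) and Greenberg's five structure facts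
(`hC h412 hcork hP108 hWL`). The `±` local input is the LANDED `SignedEC.PlusLayer.plusHondaSystemTwo_adicCompletion`.
[cite: Kobayashi2003, Thm. 1.2 and §8.4] [cite: BurungaleFlach2024, Thm. 1.1] [cite: BDKim2013, Cor. 3.15] [cite: GreenbergLNM1716, Prop. 4.12, pp. 108, 140]
[cite: PollackRubin2004, Thm. 8.2 (p > 2; the rank-0 descent)] -/
theorem signedMainConjectureCMTwoRankZero_at_unitZone_of_pub
    (hBF : bsdTriple_of_hasCM_of_L_one_ne_zero)
    (hmod : nonempty_modularParametrizationData) (hLrat : hasEntireLFunction_rat)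
    (hGZK : rank_eq_analyticRank_of_analyticRank_le_one)
    (h2 : Literature.NumberTheory.EllipticCurves.realPeriodRat_eq_unit_mul_plusPeriod_two)
    (hC : Greenberg1999.casselsSurjectivity_H1Sigma ℚ)
    (h412 : Greenberg1999.prop412_noFiniteSubmodule_H1Sigma_of_rank_one)
    (hcork : Greenberg1999.h1Sigma_zpCorank_le_degree ℚ)
    (hP108 : Greenberg1999.localQuotient_restriction_surjective ℚ)
    (hWL : Greenberg1999.h1SigmaInfty_rank_eq_one)
    (A : WeierstrassCurve ℚ) [A.IsElliptic] [A.IsGloballyMinimal]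
    (hcm : A.HasCM) (hr : A.analyticRank = 0) (hss : GoodSS A 2) (ha : A.frobeniusTrace 2 = 0)
    (hunit : ¬ 2 ∣ A.shaOrder * A.tamagawaProduct) :
    (∀ (κ : ZpExtension ℚ 2) (γ : Field.absoluteGaloisGroup ℚ), κ.IsCyclotomic → κ.IsTopGenerator γ →
      ∀ D : SignedSelmerDualData A κ γ 1, Module.IsTorsion (IwasawaAlgebra 2) D.X ∧ D.mu = 0) ∧
    KobayashiMainConjecture A 2 1 :=
  signedMainConjectureCMTwoRankZero_at_unitZone_of_honda A hBF hmod hLrat hGZK h2 hC h412 hcork hP108 hWL hcm hr hss ha hunit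
    fun κ hκ v hv ↦ SignedEC.PlusLayer.plusHondaSystemTwo_adicCompletion A hss ha κ hκ v hv

/-- **K2r0 ON THE UNIT ZONE FROM PRINT, PUB bundled** as the conjunction of the registered stub `stub_publishedInputsCMTwo` of line
`rankzero` (= T10v2's PUBCM ∧ PUBG). [cite: BurungaleFlach2024, Thm. 1.1] [cite: GreenbergLNM1716, Prop. 4.12, pp. 108, 140] -/
theorem signedMainConjectureCMTwoRankZero_at_unitZone_of_pubConj
    (hPUB : (bsdTriple_of_hasCM_of_L_one_ne_zero ∧ nonempty_modularParametrizationData ∧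
        hasEntireLFunction_rat ∧ rank_eq_analyticRank_of_analyticRank_le_one ∧
        Literature.NumberTheory.EllipticCurves.realPeriodRat_eq_unit_mul_plusPeriod_two) ∧
      (Greenberg1999.casselsSurjectivity_H1Sigma ℚ ∧ Greenberg1999.prop412_noFiniteSubmodule_H1Sigma_of_rank_one ∧
        Greenberg1999.h1Sigma_zpCorank_le_degree ℚ ∧ Greenberg1999.localQuotient_restriction_surjective ℚ ∧
        Greenberg1999.h1SigmaInfty_rank_eq_one))
    (A : WeierstrassCurve ℚ) [A.IsElliptic] [A.IsGloballyMinimal]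
    (hcm : A.HasCM) (hr : A.analyticRank = 0) (hss : GoodSS A 2) (ha : A.frobeniusTrace 2 = 0)
    (hunit : ¬ 2 ∣ A.shaOrder * A.tamagawaProduct) :
    (∀ (κ : ZpExtension ℚ 2) (γ : Field.absoluteGaloisGroup ℚ), κ.IsCyclotomic → κ.IsTopGenerator γ →
      ∀ D : SignedSelmerDualData A κ γ 1, Module.IsTorsion (IwasawaAlgebra 2) D.X ∧ D.mu = 0) ∧
    KobayashiMainConjecture A 2 1 := by
  obtain ⟨⟨hBF, hmod, hLrat, hGZK, h2⟩, hC, h412, hcork, hP108, hWL⟩ := hPUB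
  exact signedMainConjectureCMTwoRankZero_at_unitZone_of_pub hBF hmod hLrat hGZK h2 hC h412 hcork hP108 hWL A hcm hr hss ha hunit

/-! ## §2. Off the unit zone: PUB + (LD±2^k)_A + (μ♭)_A, HONDA discharged -/

/-- **K2r0 AT `A` from PUB + the one-sided Eisenstein half modulo powers of `2` + analytic `μ = 0`** (HONDA⁺@2(A) discharged by
the landed `SignedEC.PlusLayer.plusHondaSystemTwo_adicCompletion`): the off-zone door of skeleton v12.
[cite: PollackRubin2004, Thm. 7.3 (p > 2)] [cite: Kobayashi2003, Thm. 1.2, §8.4, Conjecture (p. 2)] [cite: BurungaleFlach2024, Thm. 1.1] -/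
theorem signedMainConjectureCMTwoRankZero_at_of_pub_of_lowerUpToTwoPower_of_flat
    (hBF : bsdTriple_of_hasCM_of_L_one_ne_zero)
    (hmod : nonempty_modularParametrizationData) (hLrat : hasEntireLFunction_rat)
    (hGZK : rank_eq_analyticRank_of_analyticRank_le_one)
    (h2 : Literature.NumberTheory.EllipticCurves.realPeriodRat_eq_unit_mul_plusPeriod_two)
    (hC : Greenberg1999.casselsSurjectivity_H1Sigma ℚ)
    (h412 : Greenberg1999.prop412_noFiniteSubmodule_H1Sigma_of_rank_one)
    (hcork : Greenberg1999.h1Sigma_zpCorank_le_degree ℚ)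
    (hP108 : Greenberg1999.localQuotient_restriction_surjective ℚ)
    (hWL : Greenberg1999.h1SigmaInfty_rank_eq_one)
    (A : WeierstrassCurve ℚ) [A.IsElliptic] [A.IsGloballyMinimal]
    (hcm : A.HasCM) (hr : A.analyticRank = 0) (hss : GoodSS A 2) (ha : A.frobeniusTrace 2 = 0)
    (hlow : ∀ (κ : ZpExtension ℚ 2) (γ : Field.absoluteGaloisGroup ℚ),
      κ.IsCyclotomic → κ.IsTopGenerator γ → IsCyclotomicVariable 2 γ →
      ∀ [NeZero (A.conductorNorm ℤ)] (f : CuspForm (Gamma0 (A.conductorNorm ℤ)) 2),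
        IsNewformOf A f → ∀ (ϖ : ℚ), (ϖ : ℝ) * A.realPeriodRat = plusPeriod f →
      ∀ (Lplus Lminus : IwasawaAlgebra 2), IsPollackPair f 2 Lplus Lminus →
      ∀ (D : SignedSelmerDualData A κ γ 1),
        ∃ (g h : IwasawaAlgebra 2) (m m' : ℕ), D.charIdeal = Ideal.span {g} ∧
          PowerSeries.C ((2 : ℚ_[2]) ^ m') * iwasawaToPowerSeries 2 g =
            PowerSeries.C ((2 : ℚ_[2]) ^ m * (ϖ : ℚ_[2])) * iwasawaToPowerSeries 2 (kobayashiL 1 Lplus Lminus * h))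
    (hflat : ∀ [NeZero (A.conductorNorm ℤ)] (f : CuspForm (Gamma0 (A.conductorNorm ℤ)) 2),
      IsNewformOf A f → ∀ (Lplus Lminus : IwasawaAlgebra 2), IsPollackPair f 2 Lplus Lminus →
        ∃ n : ℕ, IsUnit (PowerSeries.coeff n (kobayashiL 1 Lplus Lminus))) :
    (∀ (κ : ZpExtension ℚ 2) (γ : Field.absoluteGaloisGroup ℚ), κ.IsCyclotomic → κ.IsTopGenerator γ →
      ∀ D : SignedSelmerDualData A κ γ 1, Module.IsTorsion (IwasawaAlgebra 2) D.X ∧ D.mu = 0) ∧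
    KobayashiMainConjecture A 2 1 :=
  signedMainConjectureCMTwoRankZero_at_of_honda_of_lowerUpToTwoPower A hBF hmod hLrat hGZK h2 hC h412 hcork hP108 hWL hcm hr hss ha
    (fun κ hκ v hv ↦ SignedEC.PlusLayer.plusHondaSystemTwo_adicCompletion A hss ha κ hκ v hv) hlow hflat

end Summit.BirchSwinnertonDyer.BirchSwinnertonDyer.Theorems

end
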